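import Summits.QuantumFields.BalabanUV.Beta.D1BFx.PackedColumnBlockPairTotalMass

/-!
# `BalabanUV.Beta.D1BFx.PackedMultiplierColumnMass` — road «BF-x» for binder row D1, slot (K), PART 24 letter «M-pack» AT THE CHART OF RECORD (α′), «K0-MIX-PACK» FILE A′:
# **THE (M-b) PACKED ROWS FOR THE MULTIPLIER-COLUMN VERTEX `vertexOfM K n M` AND THE MIXED PAIR VERTEX `mixOfK K n M₂` AT ANY PACKED KERNEL WITH DISPLAYED
# `colH` ∕ `colM` ENVELOPES** — the multiplier slot lives on the coarse sublattice (`onLat ∕ cwsum`): ONE coarse slot per block, no `n⁴` slot count on that side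

HONEST DEPENDENCY (cell records, verbatim): «continuum YM on T⁴ ⇐ BetaPertH ∧ nine spine estimates (0/9 proved); BetaPertH ⇐ (D1) ∧ (D4) ∧
CAP+tail; G-an2-4 gates asym, D1 and NE2/3/4.»  HONEST FRAMING (cell contract, verbatim): «discharging `BetaPertH` makes Bałaban's UV stability
UNCONDITIONAL — a real constructive-QFT result; it is NOT the continuum limit and NOT the Clay problem.»  THIS MODULE DISCHARGES NOTHING of the
wall: [folklore] `ℓ¹` bookkeeping BY NAME over LANDED objects (this lineage's FILE 2 `PackedColumnBlockTotalMass` §1 `tsum_abs_mul_le_of_blockTotal`, FILE 4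
`PackedColumnBlockPairTotalMass` §2 `mass_nested_wsum_le_of_blockPairTotal`, d1-leaf-04's `RestJetBlockMass.stencil_mass_recentre ∕ mass_sum_wsum_le`, lit
`InterLevelTransport.onLat ∕ cwsum`, `SecondOrderResponse.colM ∕ vertexOfM ∕ mixOfK`).  No definition, no `def … : Prop`, nothing cited, 0 sorry.  Every table letter is a DISPLAYED hypothesis on an ARBITRARY family; NO (1.22) row is proved; per-word absolute-value
letters are INTERMEDIATE lemmas (an2 R-D1-g45-4 (3): the END's closing step is the PAIRED second variation); 0 root-level binders of row D1 discharged (hW ∕ hR-sockets ∕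
hSX-socket ∕ D1Tel ∕ D1Rep = 0); (J1) ONE OPEN ROW; (K) NOT closed; NOT D1, NEVER «G-an2-4 closed», NOT `BetaPertH`, NOT continuum, NOT Clay.

ABSOLUTE RULE (cell charter, verbatim): «No internally-minted statement may enter as a cited fact. Every hypothesis is either kernel-proved in
this package or a verbatim quotation of a PUBLISHED theorem with page reference. The manuscript(s) under audit are NOT citable for their own
disputed steps — they are the thing under adjudication; programme-internal (2001/route/tribunal) claims are never citable.»

WHY.  The OWNER's PART 24-hyb HEAD (d1-p2 g24 `PART24-HEAD-SPEC-g24.v1_1.md`) displays, at the STRAIGHT pin `K₀ := KInvStep n 0` of the chart of record (α′), the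
smooth second-order words `W^s := vertex2OfK K₀ S₂⁰ + mixOfK K₀ M₂ + swap + response^s` ((H3-lit); the (D-R) rest `½·tadpole G′ ((W^s − vertex2OfK K₀ S₂⁰) + …)` of
(H3-Δ) carries `mixOfK K₀ n M₂ μ y ν y′ + mixOfK K₀ n M₂ ν y′ μ y`) and the multiplier-column vertex `V^M := vertexOfM K₀ n (tabs.M 0)` inside the displaced word
`W^{M}` ((H2-M)); d1-leaf-01's TT16 `DressedMixVertexSplit`: «`vertexOfM` is NOT dressed, `mixOfK G₀ n M₂ = mixOfK K₀ n M₂ + [Λc μ y, V^M ν y′]`».  This lineage's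
«K0-PACK» (g60, FILEs A–D) typed the packed rows of `vertexOfK` ∕ `vertex2OfK` at `K₀` and named «the `mixOfK` ∕ `dM∘K2OfK` parts of `W^{smooth}` (colM-weighted)»
as NOT there.  «K0-MIX-PACK» = THREE files: FILE A′ (this lineage's `PackedMultiplierColumnMass`: the K-generic rows, the multiplier slot carried on the coarse
sublattice by lit `InterLevelTransport.onLat ∕ cwsum` — the DEFINITION of `vertexOfM` — so that FILE 2 §1 and FILE 4 §2 apply BY NAME), FILE B′ (`PackedMultiplierSlotLetters`:
the slot letters from `VertexFamily` ∕ `LocStencilFM` localisation), FILE C′ (`PackedStraightColumnMixedMass`: the straight pin, powers displayed).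

CONTENT of FILE A′ (`d = 3`; ANY packed `K : MKer 4 (Fib 3)`, block side `n`).
* §0 [folklore] plumbing: `abs_onLat_le_of_coarse` (a coarse-slot envelope in fine `ℓ¹` units passes to the extension by zero), `zero_mem_box₄`, **`sum_box_onLat`**
  (the block total of an extension by zero is its ONE coarse value), `blk_vertexOfM`, `blk_mixOfK` (the blocks as (nested) superpositions, `rfl`-level), `plainMass_blk_onLat` ∕
  `weightedMass_blk_onLat` (the block masses of an extension by zero).
* §1 [folklore]: **`mass_sum_wsum_le_of_blockTotal`** («K0-PACK» FILE A §1's superposition form for ARBITRARY enveloped weights `w i u`, `|w i u| ≤ C_w·e^{−ρ|u − n•y|₁}`),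
  **`mass_blk_vertexOfM_le_of_slotMass`** («K-MULT-MASS»: `|colM K n ν y′ ρ w| ≤ C_M·e^{−ρ|n•w − n•y′|₁}` and UNIFORM per-coarse-slot `n•w`-centred weighted masses of the
  multiplier table `≤ T j k` ⟹ every block of `vertexOfM K n M ν y′` has centred weighted mass at `n•y′`, rate `σ ≤ ρ∕4`, `≤ 4·(C_M·e^{2ρn}·Zl 4 (ρn∕2))·T j k`),
  **`mass_blk_mixOfK_le_of_blockSlotTotal`** («K-MIX-MASS», the mixed twin of FILE 4 §3: two envelopes at one rate `ρ` + FINE-BLOCK × COARSE-SLOT totals of the mixed table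
  `Σ_{b ∈ box 4 n} Σ'|blk (M₂ κ (n•y₁+b) ρ′ w) j i| ≤ T j i·e^{−θ|w − y₁|₁}` ⟹ plain mass of `blk (mixOfK K n M₂ μ y ν y′) j i`
  `≤ 16·(C_H·C_M·e^{4ρn}·e^{4ρn}·T j i·Zl 4 (ρn∕2)·Zl 4 (θ∕2)·e^{−min (ρn∕2) (θ∕2)·|y′ − y|₁})`).
NOT HERE (honest): the slot letters from the tables' localisation (FILE B′); the straight pin and its powers (FILE C′); any count of any table; the `dM∘K2OfK` response word
(tadpole-null at the pins by parity — `SpineRecursiveParity.tadpole_dM_eq_zero_of_rows`, not a mass row); the brackets with `Λ` (`W^{M}`, leaf-01's O-2 currency); any (1.22) row.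
Unit `b2b-balaban-gan24-formalise-leaf-05` (gen 61), G-an2-4 swarm leaf prover 05, road «BF-x» supplier (`colH`-weights ∕ mass-letters ∕ packed-currency lineage);
INTENT-1 «K0-MIX-PACK» FILE A′ (journal [GAN24LEAF05-G61-INTENT-1] ∕ A-1).
-/

noncomputable section

open Finset
open scoped BigOperators
open Literature.MathematicalPhysics.QuantumFieldTheory
open Literature.MathematicalPhysics.QuantumFieldTheory.LatticeForm (quo)
open Literature.MathematicalPhysics.QuantumFieldTheory.Balaban1983to89
open Literature.MathematicalPhysics.QuantumFieldTheory.Balaban1983to89.Beta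
open B12Sec2to5 (l1 l1_nonneg)
open ExpKernelCalculus (Site MKer Zl Zl_pos Zl_nonneg l1_natSmul)
open AffineAveraging (box toSite)
open OneStepResolventKernel (Fib wsum eq_zsmul_quo_of_proj)
open OneStepKernelFamily (colH KInvStep vertexOfK)
open InterLevelTransport (onLat cwsum onLat_zsmul onLat_off)
open SecondOrderResponse (colM vertexOfM mixOfK)
open KKTFluctuationEnergy (quo_zsmul_add_toSite)
open Summit.QuantumFields.BalabanUV.Beta.D1BFx.PackedKernelSplit (blk)
open Summit.QuantumFields.BalabanUV.Beta.D1BFx.RestJetBlockMass (stencil_mass_recentre mass_sum_wsum_le)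
open Summit.QuantumFields.BalabanUV.Beta.D1BFx.PackedColumnJetMass (blk_vertexOfK)
open Summit.QuantumFields.BalabanUV.Beta.D1BFx.PackedColumnBlockTotalMass (tsum_abs_mul_le_of_blockTotal)
open Summit.QuantumFields.BalabanUV.Beta.D1BFx.PackedColumnBlockPairTotalMass (mass_nested_wsum_le_of_blockPairTotal)

namespace Summit.QuantumFields.BalabanUV.Beta.D1BFx.PackedMultiplierColumnMass

/-! ## §0 Plumbing: extensions by zero from the coarse sublattice; the blocks of `vertexOfM` ∕ `mixOfK` as superpositions -/

section Plumbing

variable {n : ℕ} [NeZero n]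

/-- [folklore] A COARSE-SLOT ENVELOPE IN FINE `ℓ¹` UNITS PASSES TO THE EXTENSION BY ZERO: `|w w′| ≤ C·e^{−a|n•w′ − n•y′|₁}` (every coarse `w′`, `0 ≤ C`) gives
`|onLat n w v| ≤ C·e^{−a|v − n•y′|₁}` for every fine `v` (on the sublattice `v = n•quo v`; off it `onLat n w v = 0`). -/
theorem abs_onLat_le_of_coarse {w : (Fin (3 + 1) → ℤ) → ℝ} {C a : ℝ} {y' : Fin (3 + 1) → ℤ} (hC : 0 ≤ C)
    (hw : ∀ w', |w w'| ≤ C * Real.exp (-a * l1 ((n : ℤ) • w' - (n : ℤ) • y'))) (v : Fin (3 + 1) → ℤ) :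
    |onLat n w v| ≤ C * Real.exp (-a * l1 (v - (n : ℤ) • y')) := by
  by_cases hv : Literature.Probability.LatticeModels.Torus.proj n v = 0
  · have e := eq_zsmul_quo_of_proj (N := n) hv
    simp only [onLat, hv, if_true]
    have h := hw (quo n v)
    rwa [← e] at h
  · rw [onLat_off w hv, abs_zero]
    positivity

/-- [folklore] The origin of the box: `0 ∈ box 4 n` (`n ≥ 1`). -/
theorem zero_mem_box₄ : (fun _ : Fin (3 + 1) => (0 : ℕ)) ∈ box (3 + 1) n :=
  Fintype.mem_piFinset.2 fun _ => Finset.mem_range.2 (Nat.pos_of_ne_zero (NeZero.ne n))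

/-- [folklore] **THE BLOCK TOTAL OF AN EXTENSION BY ZERO IS ITS COARSE VALUE**: `Σ_{b ∈ box 4 n} onLat n g (n•y + toSite b) = g y` — the only point of the block
`n•y + box` on the coarse sublattice is its corner `n•y` (`quo_zsmul_add_toSite`, `toSite` injective). -/
theorem sum_box_onLat (g : (Fin (3 + 1) → ℤ) → ℝ) (y : Fin (3 + 1) → ℤ) :
    ∑ b ∈ box (3 + 1) n, onLat n g ((n : ℤ) • y + toSite b) = g y := by
  rw [Finset.sum_eq_single_of_mem (fun _ : Fin (3 + 1) => (0 : ℕ)) zero_mem_box₄]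
  · have h0 : toSite (fun _ : Fin (3 + 1) => (0 : ℕ)) = (0 : Fin (3 + 1) → ℤ) := by
      funext i; simp [AffineAveraging.toSite]
    rw [h0, add_zero, onLat_zsmul]
  · intro b hb hb0
    refine onLat_off g fun hproj => hb0 ?_
    -- on the sublattice the point is `n • quo`, and `quo (n•y + toSite b) = y`
    have e := eq_zsmul_quo_of_proj (N := n) hproj
    rw [quo_zsmul_add_toSite y hb] at e
    have ht : toSite b = (0 : Fin (3 + 1) → ℤ) := by
      have := congrArg (fun v => v - (n : ℤ) • y) e
      simpa using this
    funext i
    have hi := congrFun ht i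
    simp only [AffineAveraging.toSite, Pi.zero_apply, Nat.cast_eq_zero] at hi
    exact hi

omit [NeZero n] in
/-- [folklore] THE BLOCKS OF THE MULTIPLIER-COLUMN VERTEX AS A SUPERPOSITION ON THE COARSE SUBLATTICE (unfolding `vertexOfM` ∕ `cwsum`; `rfl`-level):
`blk (vertexOfM K n M ν y′) j k = Σ_ρ wsum (onLat n (colM K n ν y′ ρ)) (v ↦ blk (onLat n (M ρ) v) j k)`. -/
theorem blk_vertexOfM (K : MKer 4 (Fib 3)) (M : Fin (3 + 1) → (Fin (3 + 1) → ℤ) → MKer 4 (Fib 3)) (ν : Fin (3 + 1)) (y' : Fin (3 + 1) → ℤ)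
    (j k : Bool) :
    blk (vertexOfM K n M ν y') j k = ∑ ρ : Fin (3 + 1), wsum (onLat n (colM K n ν y' ρ)) (fun v => blk (onLat n (M ρ) v) j k) := by
  funext x z a b
  simp only [PackedKernelSplit.blk, SecondOrderResponse.vertexOfM, InterLevelTransport.cwsum, OneStepResolventKernel.wsum, Finset.sum_apply]

omit [NeZero n] in
/-- [folklore] THE BLOCKS OF THE MIXED PAIR VERTEX AS A NESTED SUPERPOSITION (field slot through `colH`, multiplier slot through `onLat n (colM …)`; `rfl`-level):
`blk (mixOfK K n M₂ μ y ν y′) j i = Σ_κ wsum (colH K n μ y κ) (u ↦ Σ_ρ wsum (onLat n (colM K n ν y′ ρ)) (v ↦ blk (onLat n (M₂ κ u ρ) v) j i))`. -/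
theorem blk_mixOfK (K : MKer 4 (Fib 3)) (M₂ : Fin (3 + 1) → (Fin (3 + 1) → ℤ) → Fin (3 + 1) → (Fin (3 + 1) → ℤ) → MKer 4 (Fib 3))
    (μ : Fin (3 + 1)) (y : Fin (3 + 1) → ℤ) (ν : Fin (3 + 1)) (y' : Fin (3 + 1) → ℤ) (j i : Bool) :
    blk (mixOfK K n M₂ μ y ν y') j i
      = ∑ κ : Fin (3 + 1), wsum (colH K n μ y κ)
          (fun u => ∑ ρ : Fin (3 + 1), wsum (onLat n (colM K n ν y' ρ)) (fun v => blk (onLat n (M₂ κ u ρ) v) j i)) := by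
  funext x z a b
  simp only [PackedKernelSplit.blk, SecondOrderResponse.mixOfK, SecondOrderResponse.vertexOfM, OneStepKernelFamily.vertexOfK,
    InterLevelTransport.cwsum, OneStepResolventKernel.wsum, Finset.sum_apply]

omit [NeZero n] in
/-- [folklore] The PLAIN block mass of an extension by zero is the extension by zero of the plain block masses. -/
theorem plainMass_blk_onLat (F : (Fin (3 + 1) → ℤ) → MKer 4 (Fib 3)) (j i : Bool) (v : Fin (3 + 1) → ℤ) :
    ∑' p : Site 4 × Site 4, ∑ g, ∑ f, |blk (onLat n F v) j i p.1 p.2 g f|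
      = onLat n (fun w => ∑' p : Site 4 × Site 4, ∑ g, ∑ f, |blk (F w) j i p.1 p.2 g f|) v := by
  by_cases hv : Literature.Probability.LatticeModels.Torus.proj n v = 0
  · simp only [onLat, hv, if_true]
  · simp only [onLat, hv, if_false]
    have h0 : ∀ p : Site 4 × Site 4, ∑ g : Fin (3 + 1), ∑ f : Fin (3 + 1), |blk (0 : MKer 4 (Fib 3)) j i p.1 p.2 g f| = 0 := by
      intro p
      refine Finset.sum_eq_zero fun g _ => Finset.sum_eq_zero fun f _ => ?_
      simp [PackedKernelSplit.blk]
    simp only [h0, tsum_zero]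

/-- [folklore] The WEIGHTED block mass of an extension by zero, centred at the slot itself, is the extension by zero of the weighted block masses centred
at the coarse points. -/
theorem weightedMass_blk_onLat (F : (Fin (3 + 1) → ℤ) → MKer 4 (Fib 3)) (j k : Bool) (σ : ℝ) (v : Fin (3 + 1) → ℤ) :
    ∑' p : Site 4 × Site 4, ∑ g, ∑ f, |blk (onLat n F v) j k p.1 p.2 g f| * Real.exp (σ * (l1 (p.1 - v) + l1 (p.2 - v)))
      = onLat n (fun w => ∑' p : Site 4 × Site 4, ∑ g, ∑ f,
          |blk (F w) j k p.1 p.2 g f| * Real.exp (σ * (l1 (p.1 - (n : ℤ) • w) + l1 (p.2 - (n : ℤ) • w)))) v := by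
  by_cases hv : Literature.Probability.LatticeModels.Torus.proj n v = 0
  · have e := eq_zsmul_quo_of_proj (N := n) hv
    simp only [onLat, hv, if_true]
    rw [← e]
  · simp only [onLat, hv, if_false]
    have h0 : ∀ p : Site 4 × Site 4, ∑ g : Fin (3 + 1), ∑ f : Fin (3 + 1),
        |blk (0 : MKer 4 (Fib 3)) j k p.1 p.2 g f| * Real.exp (σ * (l1 (p.1 - v) + l1 (p.2 - v))) = 0 := by
      intro p
      refine Finset.sum_eq_zero fun g _ => Finset.sum_eq_zero fun f _ => ?_
      simp [PackedKernelSplit.blk]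
    simp only [h0, tsum_zero]

end Plumbing

/-! ## §1 Generic: ANY packed kernel, the multiplier slot on the coarse sublattice -/

section Generic

variable (K : MKer 4 (Fib 3)) (n : ℕ) [NeZero n]

/-- [folklore] **SUPERPOSITION FORM FOR ARBITRARY ENVELOPED WEIGHTS** (FILE A §1 `mass_sum_wsum_colH_le_of_blockTotal` with the weights abstracted; ANY fibre `F`, any finite
index set): weights `|w i u| ≤ C_w·e^{−ρ|u − n•y|₁}` (`0 < ρ`, `0 ≤ C_w`), `0 ≤ σ ≤ ρ∕4`, a family `T i u : MKer 4 F` with summable `u`-centred `σ`-weighted masses whose BLOCK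
TOTALS are `≤ m̄T` (every index, every coarse block) ⟹ `Σ_i wsum (w i) (T i)` has centred weighted mass at `n•y`, rate `σ`, summable and
`≤ |ι|·(C_w·e^{2ρn}·Zl 4 (ρn∕2))·m̄T`. -/
theorem mass_sum_wsum_le_of_blockTotal {F : Type*} [Fintype F] {ι : Type*} [Fintype ι] {w : ι → (Fin (3 + 1) → ℤ) → ℝ}
    {T : ι → (Fin (3 + 1) → ℤ) → MKer 4 F} {Cw ρ σ mT : ℝ} (hρ : 0 < ρ) (hCw : 0 ≤ Cw) (hσ0 : 0 ≤ σ) (hσ : σ ≤ ρ / 4)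
    (y : Fin (3 + 1) → ℤ)
    (hw : ∀ i u, |w i u| ≤ Cw * Real.exp (-ρ * l1 (u - (n : ℤ) • y)))
    (hTs : ∀ i u, Summable fun p : Site 4 × Site 4 => ∑ a, ∑ b, |T i u p.1 p.2 a b| * Real.exp (σ * (l1 (p.1 - u) + l1 (p.2 - u))))
    (hTB : ∀ (i : ι) (y' : Fin (3 + 1) → ℤ), ∑ b ∈ box (3 + 1) n,
      (∑' p : Site 4 × Site 4, ∑ a, ∑ b', |T i ((n : ℤ) • y' + toSite b) p.1 p.2 a b'|
        * Real.exp (σ * (l1 (p.1 - ((n : ℤ) • y' + toSite b)) + l1 (p.2 - ((n : ℤ) • y' + toSite b))))) ≤ mT) :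
    (Summable fun p : Site 4 × Site 4 => ∑ a, ∑ b,
        |(∑ i : ι, wsum (w i) (T i)) p.1 p.2 a b| * Real.exp (σ * (l1 (p.1 - (n : ℤ) • y) + l1 (p.2 - (n : ℤ) • y)))) ∧
      ∑' p : Site 4 × Site 4, ∑ a, ∑ b,
          |(∑ i : ι, wsum (w i) (T i)) p.1 p.2 a b| * Real.exp (σ * (l1 (p.1 - (n : ℤ) • y) + l1 (p.2 - (n : ℤ) • y)))
        ≤ (Fintype.card ι : ℝ) * (Cw * Real.exp (2 * ρ * (n : ℝ)) * Zl 4 (ρ * (n : ℝ) / 2)) * mT := by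
  set Z : ℝ := Cw * Real.exp (2 * ρ * (n : ℝ)) * Zl 4 (ρ * (n : ℝ) / 2) with hZ
  set c : Site 4 := (n : ℤ) • y with hc
  set W : Site 4 × Site 4 → ℝ := fun p => Real.exp (σ * (l1 (p.1 - c) + l1 (p.2 - c))) with hW
  have hWpos : ∀ p, 0 < W p := fun p => Real.exp_pos _
  set ρ₂ : ℝ := ρ / 2 with hρ₂
  have hρ₂0 : 0 < ρ₂ := by positivity
  -- the slot function: the family's own (summable) weighted masses
  set M : ι → (Fin (3 + 1) → ℤ) → ℝ := fun i u =>
    ∑' p : Site 4 × Site 4, ∑ a, ∑ b, |T i u p.1 p.2 a b| * Real.exp (σ * (l1 (p.1 - u) + l1 (p.2 - u))) with hM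
  have hM0 : ∀ i u, 0 ≤ M i u := fun i u =>
    tsum_nonneg fun p => Finset.sum_nonneg fun a _ => Finset.sum_nonneg fun b _ => by positivity
  -- per stencil: recentred letter `M i u·e^{2σ|u − c|₁}`
  have hrec : ∀ i u, (Summable fun p : Site 4 × Site 4 => ∑ a, ∑ b, |T i u p.1 p.2 a b| * W p) ∧
      ∑' p : Site 4 × Site 4, ∑ a, ∑ b, |T i u p.1 p.2 a b| * W p ≤ M i u * Real.exp (2 * σ * l1 (u - c)) :=
    fun i u => stencil_mass_recentre hσ0 u c (hTs i u) le_rfl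
  -- per index: the recentred weight `w i u·e^{2σ|u − c|₁}` has the envelope `C_w·e^{−(ρ∕2)|u − c|₁}`; FILE 2 §1 against the block totals
  have hwi : ∀ i : ι,
      (Summable fun u : Site 4 => |w i u| * (M i u * Real.exp (2 * σ * l1 (u - c)))) ∧
      ∑' u : Site 4, |w i u| * (M i u * Real.exp (2 * σ * l1 (u - c))) ≤ Z * mT := by
    intro i
    have henv : ∀ u : Fin (3 + 1) → ℤ, |w i u * Real.exp (2 * σ * l1 (u - c))| ≤ Cw * Real.exp (-ρ₂ * l1 (u - (n : ℤ) • y)) := by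
      intro u
      rw [abs_mul, abs_of_pos (Real.exp_pos _), ← hc]
      have h1 := hw i u
      have hl := l1_nonneg (u - c)
      calc |w i u| * Real.exp (2 * σ * l1 (u - c))
          ≤ (Cw * Real.exp (-ρ * l1 (u - c))) * Real.exp (2 * σ * l1 (u - c)) :=
            mul_le_mul_of_nonneg_right h1 (Real.exp_pos _).le
        _ = Cw * Real.exp (-ρ * l1 (u - c) + 2 * σ * l1 (u - c)) := by rw [Real.exp_add]; ring
        _ ≤ Cw * Real.exp (-ρ₂ * l1 (u - c)) := by
            refine mul_le_mul_of_nonneg_left (Real.exp_le_exp.2 ?_) hCw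
            rw [hρ₂]
            nlinarith [hl, hσ, hρ]
    obtain ⟨hs, hb⟩ := tsum_abs_mul_le_of_blockTotal (D := 3 + 1) (n := n)
      (w := fun u => w i u * Real.exp (2 * σ * l1 (u - c))) (m := M i) y hρ₂0 hCw henv (hM0 i) (hTB i)
    have e : (fun u : Fin (3 + 1) → ℤ => |w i u| * (M i u * Real.exp (2 * σ * l1 (u - c))))
        = fun u => |w i u * Real.exp (2 * σ * l1 (u - c))| * M i u := by
      funext u
      rw [abs_mul, abs_of_pos (Real.exp_pos _)]; ring
    rw [e]
    refine ⟨hs, hb.trans (le_of_eq ?_)⟩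
    have e1 : ρ₂ * (((3 + 1 : ℕ) : ℕ) : ℝ) * (n : ℝ) = 2 * ρ * (n : ℝ) := by rw [hρ₂]; push_cast; ring
    have e2 : ρ₂ * (n : ℝ) = ρ * (n : ℝ) / 2 := by rw [hρ₂]; ring
    rw [e1, e2]
  have hsum := mass_sum_wsum_le (Finset.univ : Finset ι)
    (w := fun i u => w i u) (K := fun i u => T i u) (M := fun _ => Z * mT) hWpos (fun i u => (hrec i u).1)
    (fun i u => (hrec i u).2) (fun i => (hwi i).1) (fun i => (hwi i).2)
  refine ⟨hsum.1, hsum.2.trans (le_of_eq ?_)⟩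
  rw [Finset.sum_const, Finset.card_univ, nsmul_eq_mul]
  ring

/-- [folklore] **THE (M-b) ROW OF THE MULTIPLIER-COLUMN VERTEX, ANY PACKED KERNEL** («K-MULT-MASS»): a multiplier-column envelope in fine `ℓ¹` units
`|colM K n ν y′ ρ w| ≤ C_M·e^{−ρ|n•w − n•y′|₁}` (`0 < ρ`, `0 ≤ C_M`), `0 ≤ σ ≤ ρ∕4`, and a multiplier table `M ρ w` (one kernel per COARSE bond) whose blocks have summable
`n•w`-centred `σ`-weighted masses, UNIFORMLY `≤ T j k`, give: every block of `vertexOfM K n M ν y′` has centred weighted mass at `n•y′`, rate `σ`, summable and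
`≤ 4·(C_M·e^{2ρn}·Zl 4 (ρn∕2))·T j k` — §1's superposition form with the weights `onLat n (colM K n ν y′ ρ)`; the block total of the slot function is its ONE coarse value
(`sum_box_onLat`): no `n⁴` slot count on the multiplier side. -/
theorem mass_blk_vertexOfM_le_of_slotMass {M : Fin (3 + 1) → (Fin (3 + 1) → ℤ) → MKer 4 (Fib 3)} {CM ρ σ : ℝ} {T : Bool → Bool → ℝ}
    (hρ : 0 < ρ) (hCM : 0 ≤ CM) (hσ0 : 0 ≤ σ) (hσ : σ ≤ ρ / 4) (ν : Fin (3 + 1)) (y' : Fin (3 + 1) → ℤ)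
    (hcolM : ∀ ρ' w, |colM K n ν y' ρ' w| ≤ CM * Real.exp (-ρ * l1 ((n : ℤ) • w - (n : ℤ) • y')))
    (hMs : ∀ ρ' w j k, Summable fun p : Site 4 × Site 4 =>
      ∑ g, ∑ f, |blk (M ρ' w) j k p.1 p.2 g f| * Real.exp (σ * (l1 (p.1 - (n : ℤ) • w) + l1 (p.2 - (n : ℤ) • w))))
    (hMm : ∀ ρ' w j k, ∑' p : Site 4 × Site 4,
      ∑ g, ∑ f, |blk (M ρ' w) j k p.1 p.2 g f| * Real.exp (σ * (l1 (p.1 - (n : ℤ) • w) + l1 (p.2 - (n : ℤ) • w))) ≤ T j k)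
    (j k : Bool) :
    (Summable fun p : Site 4 × Site 4 => ∑ g, ∑ f,
        |blk (vertexOfM K n M ν y') j k p.1 p.2 g f| * Real.exp (σ * (l1 (p.1 - (n : ℤ) • y') + l1 (p.2 - (n : ℤ) • y')))) ∧
      ∑' p : Site 4 × Site 4, ∑ g, ∑ f,
          |blk (vertexOfM K n M ν y') j k p.1 p.2 g f| * Real.exp (σ * (l1 (p.1 - (n : ℤ) • y') + l1 (p.2 - (n : ℤ) • y')))
        ≤ 4 * (CM * Real.exp (2 * ρ * (n : ℝ)) * Zl 4 (ρ * (n : ℝ) / 2)) * T j k := by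
  rw [blk_vertexOfM]
  have hT0 : 0 ≤ T j k := le_trans (tsum_nonneg fun p => Finset.sum_nonneg fun g _ => Finset.sum_nonneg fun f _ => by positivity) (hMm 0 0 j k)
  -- the slots: weighted masses of the extensions by zero, centred at the slot
  have hTs : ∀ (ρ' : Fin (3 + 1)) (v : Fin (3 + 1) → ℤ), Summable fun p : Site 4 × Site 4 =>
      ∑ g, ∑ f, |blk (onLat n (M ρ') v) j k p.1 p.2 g f| * Real.exp (σ * (l1 (p.1 - v) + l1 (p.2 - v))) := by
    intro ρ' v
    by_cases hv : Literature.Probability.LatticeModels.Torus.proj n v = 0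
    · have e := eq_zsmul_quo_of_proj (N := n) hv
      have h := hMs ρ' (quo n v) j k
      rw [← e] at h
      simp only [onLat, hv, if_true]
      exact h
    · simp only [onLat, hv, if_false]
      have h0 : (fun p : Site 4 × Site 4 => ∑ g : Fin (3 + 1), ∑ f : Fin (3 + 1),
          |blk (0 : MKer 4 (Fib 3)) j k p.1 p.2 g f| * Real.exp (σ * (l1 (p.1 - v) + l1 (p.2 - v)))) = fun _ => 0 := by
        funext p
        refine Finset.sum_eq_zero fun g _ => Finset.sum_eq_zero fun f _ => ?_
        simp [PackedKernelSplit.blk]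
      rw [h0]
      exact summable_zero
  have hTB : ∀ (ρ' : Fin (3 + 1)) (y₁ : Fin (3 + 1) → ℤ), ∑ b ∈ box (3 + 1) n,
      (∑' p : Site 4 × Site 4, ∑ g, ∑ f, |blk (onLat n (M ρ') ((n : ℤ) • y₁ + toSite b)) j k p.1 p.2 g f|
        * Real.exp (σ * (l1 (p.1 - ((n : ℤ) • y₁ + toSite b)) + l1 (p.2 - ((n : ℤ) • y₁ + toSite b))))) ≤ T j k := by
    intro ρ' y₁
    have e : ∀ b ∈ box (3 + 1) n,
        (∑' p : Site 4 × Site 4, ∑ g, ∑ f, |blk (onLat n (M ρ') ((n : ℤ) • y₁ + toSite b)) j k p.1 p.2 g f|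
          * Real.exp (σ * (l1 (p.1 - ((n : ℤ) • y₁ + toSite b)) + l1 (p.2 - ((n : ℤ) • y₁ + toSite b)))))
        = onLat n (fun w => ∑' p : Site 4 × Site 4, ∑ g, ∑ f,
            |blk (M ρ' w) j k p.1 p.2 g f| * Real.exp (σ * (l1 (p.1 - (n : ℤ) • w) + l1 (p.2 - (n : ℤ) • w)))) ((n : ℤ) • y₁ + toSite b) :=
      fun b _ => weightedMass_blk_onLat (M ρ') j k σ _
    rw [Finset.sum_congr rfl e, sum_box_onLat]
    exact hMm ρ' y₁ j k
  have h := mass_sum_wsum_le_of_blockTotal n (ι := Fin (3 + 1)) (w := fun ρ' => onLat n (colM K n ν y' ρ'))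
    (T := fun ρ' v => blk (onLat n (M ρ') v) j k) (mT := T j k) hρ hCM hσ0 hσ y'
    (fun ρ' v => abs_onLat_le_of_coarse (y' := y') hCM (hcolM ρ') v) hTs hTB
  refine ⟨h.1, h.2.trans (le_of_eq ?_)⟩
  rw [Fintype.card_fin]
  push_cast
  ring

/-- [folklore] **THE (M-b) ROW OF THE MIXED PAIR VERTEX, ANY PACKED KERNEL** («K-MIX-MASS»; the mixed twin of FILE 4 §3 `mass_blk_vertex2OfK_le_of_blockPairTotal`): an
`ℋ`-column envelope `|colH K n μ y κ u| ≤ C_H·e^{−ρ|u − n•y|₁}` and a multiplier-column envelope `|colM K n ν y′ ρ′ w| ≤ C_M·e^{−ρ|n•w − n•y′|₁}` at ONE rate `ρ > 0`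
(`0 ≤ C_H, C_M`), per-slot-pair summable plain block masses of the field–multiplier table `M₂ κ u ρ′ w`, and FINE-BLOCK × COARSE-SLOT totals
`Σ_{b ∈ box 4 n} Σ'|blk (M₂ κ (n•y₁ + b) ρ′ w) j i| ≤ T j i·e^{−θ|w − y₁|₁}` (`0 < θ`; every fine block `y₁`, every coarse slot `w`) give a summable plain mass of
`blk (mixOfK K n M₂ μ y ν y′) j i` bounded by `16·(C_H·C_M·e^{4ρn}·e^{4ρn}·T j i·Zl 4 (ρn∕2)·Zl 4 (θ∕2)·e^{−min (ρn∕2) (θ∕2)·|y′ − y|₁})` — FILE 4 §2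
`mass_nested_wsum_le_of_blockPairTotal` with the second weight `onLat n (colM K n ν y′ ρ′)`; the block-pair total of the extended table is the fine-block ×
coarse-slot total (`sum_box_onLat`). -/
theorem mass_blk_mixOfK_le_of_blockSlotTotal {M₂ : Fin (3 + 1) → (Fin (3 + 1) → ℤ) → Fin (3 + 1) → (Fin (3 + 1) → ℤ) → MKer 4 (Fib 3)}
    {CH CM ρ θ : ℝ} {T : Bool → Bool → ℝ} (hρ : 0 < ρ) (hθ : 0 < θ) (hCH : 0 ≤ CH) (hCM : 0 ≤ CM)
    (μ : Fin (3 + 1)) (y : Fin (3 + 1) → ℤ) (ν : Fin (3 + 1)) (y' : Fin (3 + 1) → ℤ)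
    (hcolH : ∀ κ u, |colH K n μ y κ u| ≤ CH * Real.exp (-ρ * l1 (u - (n : ℤ) • y)))
    (hcolM : ∀ ρ' w, |colM K n ν y' ρ' w| ≤ CM * Real.exp (-ρ * l1 ((n : ℤ) • w - (n : ℤ) • y')))
    (hPs : ∀ κ u ρ' w j i, Summable fun p : Site 4 × Site 4 => ∑ g, ∑ f, |blk (M₂ κ u ρ' w) j i p.1 p.2 g f|)
    (hPB : ∀ (κ ρ' : Fin (3 + 1)) (y₁ w : Fin (3 + 1) → ℤ) (j i : Bool), ∑ b ∈ box (3 + 1) n,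
      (∑' p : Site 4 × Site 4, ∑ g, ∑ f, |blk (M₂ κ ((n : ℤ) • y₁ + toSite b) ρ' w) j i p.1 p.2 g f|)
        ≤ T j i * Real.exp (-θ * l1 (w - y₁)))
    (j i : Bool) :
    (Summable fun p : Site 4 × Site 4 => ∑ g, ∑ f, |blk (mixOfK K n M₂ μ y ν y') j i p.1 p.2 g f|) ∧
      ∑' p : Site 4 × Site 4, ∑ g, ∑ f, |blk (mixOfK K n M₂ μ y ν y') j i p.1 p.2 g f|
        ≤ 16 * (CH * CM * (Real.exp (ρ * (4 : ℝ) * (n : ℝ)) * Real.exp (ρ * (4 : ℝ) * (n : ℝ))) * T j i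
            * (Zl 4 (ρ * (n : ℝ) / 2) * Zl 4 (θ / 2)) * Real.exp (-(min (ρ * (n : ℝ) / 2) (θ / 2)) * l1 (y' - y))) := by
  rw [blk_mixOfK]
  -- the slots of the extended table: plain masses, summable
  have hPs' : ∀ (κ : Fin (3 + 1)) (u : Fin (3 + 1) → ℤ) (ρ' : Fin (3 + 1)) (v : Fin (3 + 1) → ℤ),
      Summable fun p : Site 4 × Site 4 => ∑ g, ∑ f, |blk (onLat n (M₂ κ u ρ') v) j i p.1 p.2 g f| := by
    intro κ u ρ' v
    by_cases hv : Literature.Probability.LatticeModels.Torus.proj n v = 0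
    · simp only [onLat, hv, if_true]
      exact hPs κ u ρ' (quo n v) j i
    · simp only [onLat, hv, if_false]
      have h0 : (fun p : Site 4 × Site 4 => ∑ g : Fin (3 + 1), ∑ f : Fin (3 + 1), |blk (0 : MKer 4 (Fib 3)) j i p.1 p.2 g f|) = fun _ => 0 := by
        funext p
        refine Finset.sum_eq_zero fun g _ => Finset.sum_eq_zero fun f _ => ?_
        simp [PackedKernelSplit.blk]
      rw [h0]
      exact summable_zero
  -- the block-pair totals of the extended table are the fine-block × coarse-slot totals
  have hPB' : ∀ (κ ρ' : Fin (3 + 1)) (y₁ y₂ : Fin (3 + 1) → ℤ), ∑ b ∈ box (3 + 1) n, ∑ b' ∈ box (3 + 1) n,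
      (∑' p : Site 4 × Site 4, ∑ g, ∑ f,
        |blk (onLat n (M₂ κ ((n : ℤ) • y₁ + toSite b) ρ') ((n : ℤ) • y₂ + toSite b')) j i p.1 p.2 g f|)
        ≤ T j i * Real.exp (-θ * l1 (y₂ - y₁)) := by
    intro κ ρ' y₁ y₂
    have e : ∀ b ∈ box (3 + 1) n, ∑ b' ∈ box (3 + 1) n,
        (∑' p : Site 4 × Site 4, ∑ g, ∑ f,
          |blk (onLat n (M₂ κ ((n : ℤ) • y₁ + toSite b) ρ') ((n : ℤ) • y₂ + toSite b')) j i p.1 p.2 g f|)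
        = ∑' p : Site 4 × Site 4, ∑ g, ∑ f, |blk (M₂ κ ((n : ℤ) • y₁ + toSite b) ρ' y₂) j i p.1 p.2 g f| := by
      intro b _
      rw [Finset.sum_congr rfl fun b' _ => plainMass_blk_onLat (M₂ κ ((n : ℤ) • y₁ + toSite b) ρ') j i _, sum_box_onLat]
    rw [Finset.sum_congr rfl e]
    exact hPB κ ρ' y₁ y₂ j i
  have h := mass_nested_wsum_le_of_blockPairTotal (D := 4) (n := n) (ι := Fin (3 + 1)) (w₁ := fun κ => colH K n μ y κ)
    (w₂ := fun ρ' => onLat n (colM K n ν y' ρ')) (P := fun κ u ρ' v => blk (onLat n (M₂ κ u ρ') v) j i) (T := T j i) y y' hρ hθ hCH hCM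
    (fun κ u => hcolH κ u) (fun ρ' v => abs_onLat_le_of_coarse (y' := y') hCM (hcolM ρ') v) hPs' hPB'
  refine ⟨h.1, h.2.trans (le_of_eq ?_)⟩
  rw [Fintype.card_fin]
  push_cast
  ring

end Generic

end Summit.QuantumFields.BalabanUV.Beta.D1BFx.PackedMultiplierColumnMass

end
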